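import Literature.Probability.LatticeModels.GlauberLogSobolevFatRectangles
import Literature.Probability.LatticeModels.GlauberBoundaryGradientUniform
import HarnessLib

/-!
# [Mar99] Theorem 4.6, the scale step with rate `1 + K/√L`, PROVED

Topic `Literature/Probability/LatticeModels`; cell `ym-ir`, seat lit-3 (census rows B2/B4).  Theorems only
(D-0026).  [Mar99] F. Martinelli, LNM 1717 (1999), Theorem 4.6, proof, (4.25): «the width of the overlap …
can be taken much smaller, e.g. `√L`; … `c(2L) ≤ (1 + k/√L) c(L)`».  This file makes the choice of parameters
in the explicit step `fatRectangles_logSobolev_step` (strip period `⌊√L'⌋`, overlap `⌊√L'⌋ − r`,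
`ρ = ⌊√L'⌋ − 2r`, `N = ⌊L'/(12⌊√L'⌋)⌋ − 1` strips; boundary-gradient constants `(k, m/32)` from Corollary 4.9
`boundaryGradient_bound_fatRectangles`) and verifies, for `L'` large, the smallness `κ̄(L') ≤ 1/(4L')` of the
two-block error (super-polynomially small, exactly as in the tree's `FatRectanglePoincareScaling`),
`η ≤ 1/√L'`, `1/N ≤ 96/√L'`, whence the factor `F² ≤ 1 + K/√L'`:
`Glauber.fatRectangles_logSobolev_step_rate`.
SIBLING-SETTING result (`±1` spins, range `r`); the Yang–Mills gap is not touched.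
[cite: Martinelli1999, Theorem 4.6, proof, (4.25)]
-/

open MeasureTheory ProbabilityTheory Finset Filter Topology

noncomputable section

namespace Literature.Probability.LatticeModels

namespace Glauber

variable {r : ℕ} (U : FRPotential 2 ℤˣ r) (β : ℝ)

/-- Polynomial times decaying exponential tends to zero along the naturals. [folklore] -/
private theorem tendsto_const_mul_pow_mul_exp_neg₅ {a : ℝ} (ha : 0 < a) (n : ℕ) (K : ℝ) :
    Tendsto (fun l : ℕ => K * ((l : ℝ) ^ n * Real.exp (-(a * (l : ℝ))))) atTop (𝓝 0) := by
  have hx : Tendsto (fun l : ℕ => a * (l : ℝ)) atTop atTop :=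
    Tendsto.const_mul_atTop ha tendsto_natCast_atTop_atTop
  have h0 := (Real.tendsto_pow_mul_exp_neg_atTop_nhds_zero n).comp hx
  have heq : (fun l : ℕ => K * ((l : ℝ) ^ n * Real.exp (-(a * (l : ℝ))))) =
      fun l : ℕ => (K * (1 / a) ^ n) * ((a * (l : ℝ)) ^ n * Real.exp (-(a * (l : ℝ)))) := by
    funext l
    rw [mul_pow, one_div, inv_pow]
    field_simp
  rw [heq]
  simpa using tendsto_const_nhds.mul h0

/-- `(1 − κ/(1−κ))⁻² ≤ 1 + x` when `0 ≤ κ ≤ x/16`, `x ≤ 1`. [folklore] -/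
private theorem inv_one_sub_div_sq_le {κ x : ℝ} (hκ0 : 0 ≤ κ) (hκ : κ ≤ x / 16) (hx : x ≤ 1) :
    ((1 - κ / (1 - κ))⁻¹) ^ 2 ≤ 1 + x := by
  set ε := κ / (1 - κ) with hε
  have hκ1 : κ ≤ 1 / 16 := hκ.trans (by linarith)
  have hε0 : 0 ≤ ε := div_nonneg hκ0 (by linarith)
  have hε2 : ε ≤ 2 * κ := by
    rw [hε, div_le_iff₀ (by linarith)]; nlinarith
  have hε8 : ε ≤ 1 / 8 := by linarith
  have hεx : 8 * ε ≤ x := by linarith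
  have h1e : 0 < 1 - ε := by linarith
  rw [inv_pow, inv_le_iff_one_le_mul₀ (by positivity)]
  have hA : 1 - 2 * ε ≤ (1 - ε) ^ 2 := by nlinarith [sq_nonneg ε]
  have hB : (1 + 8 * ε) * (1 - 2 * ε) ≤ (1 + x) * (1 - ε) ^ 2 :=
    mul_le_mul (by linarith) hA (by linarith) (by linarith)
  have hC : 16 * ε * ε ≤ 16 * ε * (1 / 8) := mul_le_mul_of_nonneg_left hε8 (by positivity)
  linarith

/-- The arithmetic of the rate: `F² ≤ 1 + 3K₀ x` for `F = E₂((1+η)(1+ν) + k₁ν)` with `E₂ ≤ 1 + x`, `η ≤ x`,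
`ν ≤ 96x`, `K₀ = 100 + 96 k₁`, `K₀ x ≤ 1`. [folklore] -/
private theorem rate_sq_le {E2 η ν k₁ x K₀ : ℝ} (hx0 : 0 ≤ x) (hE1 : 1 ≤ E2) (hE2 : E2 ≤ 1 + x)
    (hη0 : 0 ≤ η) (hη : η ≤ x) (hν0 : 0 ≤ ν) (hν : ν ≤ 96 * x) (hk₁ : 0 ≤ k₁) (hK₀ : K₀ = 100 + 96 * k₁)
    (hxK : K₀ * x ≤ 1) :
    (E2 * ((1 + η) * (1 + ν) + k₁ * ν)) ^ 2 ≤ 1 + 3 * K₀ * x := by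
  have hK₀0 : 100 ≤ K₀ := by rw [hK₀]; linarith
  have hx100 : 100 * x ≤ 1 := by nlinarith
  -- the inner factor
  have hI1 : (1 + η) * (1 + ν) ≤ (1 + x) * (1 + 96 * x) :=
    mul_le_mul (by linarith) (by linarith) (by linarith) (by linarith)
  have hI2 : k₁ * ν ≤ k₁ * (96 * x) := mul_le_mul_of_nonneg_left hν hk₁
  have hxx : 96 * x * x ≤ x := by nlinarith
  have hI : (1 + η) * (1 + ν) + k₁ * ν ≤ 1 + (98 + 96 * k₁) * x := by nlinarith
  have hI0 : 0 ≤ (1 + η) * (1 + ν) + k₁ * ν := by positivity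
  -- the factor `F ≤ 1 + K₀ x`
  have hF : E2 * ((1 + η) * (1 + ν) + k₁ * ν) ≤ (1 + x) * (1 + (98 + 96 * k₁) * x) :=
    mul_le_mul hE2 hI hI0 (by linarith)
  have hq : (98 + 96 * k₁) * x ≤ 1 := by nlinarith
  have hF' : E2 * ((1 + η) * (1 + ν) + k₁ * ν) ≤ 1 + K₀ * x := by
    have : (1 + x) * (1 + (98 + 96 * k₁) * x) ≤ 1 + K₀ * x := by
      have h1 : x * ((98 + 96 * k₁) * x) ≤ x * 1 := mul_le_mul_of_nonneg_left hq hx0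
      rw [hK₀]; nlinarith
    exact hF.trans this
  have hF0 : 0 ≤ E2 * ((1 + η) * (1 + ν) + k₁ * ν) := mul_nonneg (zero_le_one.trans hE1) hI0
  have hKx0 : 0 ≤ K₀ * x := by nlinarith
  calc (E2 * ((1 + η) * (1 + ν) + k₁ * ν)) ^ 2 ≤ (1 + K₀ * x) ^ 2 := pow_le_pow_left₀ hF0 hF' 2
    _ = 1 + 2 * (K₀ * x) + (K₀ * x) * (K₀ * x) := by ring
    _ ≤ 1 + 2 * (K₀ * x) + (K₀ * x) * 1 := by
        have := mul_le_mul_of_nonneg_left hxK hKx0; linarith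
    _ = 1 + 3 * K₀ * x := by ring

/-- `96/√L' ≥ 1/N` from `√L'/48 ≤ N + 1` and `√L' ≥ 96`. [folklore] -/
private theorem inv_le_mul_inv_sqrt {s N : ℝ} (hs : 96 ≤ s) (hN : s / 48 ≤ N + 1) (hN0 : 0 < N) :
    1 / N ≤ 96 * (1 / s) := by
  have hs0 : 0 < s := by linarith
  have hN' : s / 96 ≤ N := by linarith
  rw [mul_one_div, div_le_div_iff₀ hN0 hs0, one_mul]
  linarith

set_option maxHeartbeats 4000000 in
/-- **[Mar99] Theorem 4.6, the scale step with rate `1 + K/√L'`**: there are `K > 0` and `L₁` such that for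
`L' ≥ L₁`, a log-Sobolev constant `c_s ≥ 0` on `𝓡_{L'}` (all boundary conditions) implies the log-Sobolev
constant `(1 + K/√L') c_s` on `𝓡_{L''}` whenever `3L'' ≤ 4L'`. [cite: Martinelli1999, Theorem 4.6, proof, (4.25)] -/
theorem fatRectangles_logSobolev_step_rate {lS : ℕ} {m : ℝ} (hm : 0 < m)
    (hSMT : ∀ L : ℕ, ∀ Q ∈ fatRectangles L, SMT (U.spec β) Q lS m) :
    ∃ K : ℝ, 0 < K ∧ ∃ L₁ : ℕ, ∀ L' : ℕ, L₁ ≤ L' → ∀ cs : ℝ, 0 ≤ cs →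
      (∀ Q ∈ fatRectangles L', ∀ τ : Site 2 → ℤˣ, LogSobolevIneq (U.spec β Q τ) Q cs) →
      ∀ L'' : ℕ, 3 * L'' ≤ 4 * L' → ∀ Q ∈ fatRectangles L'', ∀ τ : Site 2 → ℤˣ,
        LogSobolevIneq (U.spec β Q τ) Q ((1 + K / Real.sqrt L') * cs) := by
  classical
  obtain ⟨R, hR1, hR⟩ := exists_flipWeight_bounds U β
  obtain ⟨k, hk1, hGB⟩ := boundaryGradient_bound_fatRectangles U β hm hSMT
  have hR0 : 0 < R := by linarith
  have hk0 : 0 ≤ k := zero_le_one.trans hk1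
  set m' : ℝ := m / 32 with hm'
  have hm'pos : 0 < m' := by positivity
  -- the constants of the box step
  set K₁ : ℝ := (2 * (1 - Real.exp (-(m' / 2)))⁻¹) ^ 2 with hK₁
  set K₂ : ℝ := (2 * (1 - Real.exp (-(m' / 2 / 2)))⁻¹) ^ 2 with hK₂
  have hK₁0 : 0 ≤ K₁ := sq_nonneg _
  have hK₂0 : 0 ≤ K₂ := sq_nonneg _
  set k₁ : ℝ := k * (1 + K₁) with hk₁
  have hk₁0 : 0 ≤ k₁ := by positivity
  set K₀ : ℝ := 100 + 96 * k₁ with hK₀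
  have hK₀0 : 0 < K₀ := by positivity
  -- smallness thresholds
  set α : ℝ := R ^ 6 * (2 * r + 1 : ℝ) ^ 2 * (2 * r + 1 : ℝ) ^ 2 with hα
  have hα0 : 0 ≤ α := by positivity
  set Cψ : ℝ := 2 ^ 21 * α * Real.exp (4 * m * r) with hCψ
  have htend := tendsto_const_mul_pow_mul_exp_neg₅ hm 12 Cψ
  obtain ⟨δ₀, hδ₀⟩ : ∃ δ₀ : ℕ, ∀ δ ≥ δ₀, Cψ * ((δ : ℝ) ^ 12 * Real.exp (-(m * (δ : ℝ)))) < 1 :=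
    eventually_atTop.1 (htend.eventually (gt_mem_nhds one_pos))
  set Cη : ℝ := 2 * k * K₂ * Real.exp (m' / 2 * r) with hCη
  have htend' := tendsto_const_mul_pow_mul_exp_neg₅ (a := m' / 2) (by positivity) 1 Cη
  obtain ⟨δ₁, hδ₁⟩ : ∃ δ₁ : ℕ, ∀ δ ≥ δ₁, Cη * ((δ : ℝ) ^ 1 * Real.exp (-(m' / 2 * (δ : ℝ)))) < 1 :=
    eventually_atTop.1 (htend'.eventually (gt_mem_nhds one_pos))
  set D : ℕ := max (max (max δ₀ δ₁) (max 96 ⌈K₀⌉₊)) (lS + 4 * r + 4) with hD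
  refine ⟨3 * K₀, by positivity, D * D, ?_⟩
  intro L' hL' cs hcs hLSI L'' hL'' Q hQ τ
  -- the parameters
  set δ := Nat.sqrt L' with hδ
  have hDδ : D ≤ δ := Nat.le_sqrt.2 hL'
  have hδ₀δ : δ₀ ≤ δ := le_trans (le_trans (le_trans (le_max_left _ _) (le_max_left _ _)) (le_max_left _ _)) hDδ
  have hδ₁δ : δ₁ ≤ δ := le_trans (le_trans (le_trans (le_max_right _ _) (le_max_left _ _)) (le_max_left _ _)) hDδ
  have hδ96 : 96 ≤ δ := le_trans (le_trans (le_trans (le_max_left _ _) (le_max_right _ _)) (le_max_left _ _)) hDδ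
  have hδK₀ : ⌈K₀⌉₊ ≤ δ := le_trans (le_trans (le_trans (le_max_right _ _) (le_max_right _ _)) (le_max_left _ _)) hDδ
  have hδl : lS + 4 * r + 4 ≤ δ := le_trans (le_max_right _ _) hDδ
  have hδL : δ * δ ≤ L' := Nat.sqrt_le L'
  have hLδ : L' < (δ + 1) * (δ + 1) := Nat.lt_succ_sqrt L'
  set ρ := δ - 2 * r with hρ
  have hρr : ρ + 2 * r = δ := by omega
  set N := L' / (12 * δ) - 1 with hN
  have hdiv2 : 2 ≤ L' / (12 * δ) := by
    rw [Nat.le_div_iff_mul_le (by omega)]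
    nlinarith
  have hN1 : N + 1 = L' / (12 * δ) := by omega
  have hNpos : 0 < N := by omega
  have hNδ : 12 * (N * δ + δ) ≤ L' := by
    have h1 : L' / (12 * δ) * (12 * δ) ≤ L' := Nat.div_mul_le_self L' (12 * δ)
    rw [← hN1] at h1
    nlinarith
  have hNδ' : 12 * (N * (δ - r + r) + (δ - r + r)) ≤ L' := by
    have e : δ - r + r = δ := by omega
    rw [e]; exact hNδ
  have hρL : 10 * (ρ + 1) ≤ L' := by
    have : 10 * (δ + 1) ≤ δ * δ := by nlinarith
    omega
  -- the two-block error `κ(L') ≤ 1/(4L')`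
  set A : ℝ := α * ((4 * L' ^ 2 : ℕ) : ℝ) * ((2 * (ρ + r) + 1) ^ 2 : ℕ) *
    Real.exp (-(m * ((ρ : ℝ) - 2 * r))) with hA
  set κ : ℝ := (1 + R ^ 6 * (2 * r + 1 : ℝ) ^ 2 * (2 * r + 1 : ℝ) ^ 2 * ((4 * L' ^ 2 : ℕ) : ℝ) *
    ((2 * (ρ + r) + 1) ^ 2 : ℕ) * Real.exp (-(m * ((ρ : ℝ) - 2 * r)))) ^ (4 * L' ^ 2) - 1 with hκ
  have hκA : κ = (1 + A) ^ (4 * L' ^ 2) - 1 := by rw [hκ, hA, hα]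
  have hA0 : 0 ≤ A := by positivity
  have hδ1 : (1 : ℝ) ≤ δ := by exact_mod_cast (show 1 ≤ δ by omega)
  have hδr : ((ρ : ℕ) : ℝ) = (δ : ℝ) - 2 * r := by
    have : 2 * r ≤ δ := by omega
    rw [hρ, Nat.cast_sub this]; push_cast; ring
  have hLδ' : (L' : ℝ) < ((δ : ℝ) + 1) ^ 2 := by
    have : ((L' : ℕ) : ℝ) < (((δ + 1) * (δ + 1) : ℕ) : ℝ) := by exact_mod_cast hLδ
    push_cast at this; nlinarith
  have hL'pos : (0 : ℝ) < L' := by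
    have : (1 : ℝ) ≤ δ * δ := by nlinarith
    have h2 : ((δ * δ : ℕ) : ℝ) ≤ L' := by exact_mod_cast hδL
    push_cast at h2; linarith
  -- `A · M ≤ 64 α e^{4mr} (δ+1)^{10} e^{−mδ}`
  have hexp : Real.exp (-(m * ((ρ : ℝ) - 2 * r))) = Real.exp (4 * m * r) * Real.exp (-(m * δ)) := by
    rw [← Real.exp_add, hδr]; ring_nf
  have hP : (((2 * (ρ + r) + 1) ^ 2 : ℕ) : ℝ) ≤ 4 * ((δ : ℝ) + 1) ^ 2 := by
    have h1 : 2 * (ρ + r) + 1 ≤ 2 * δ + 1 := by omega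
    have h2 : (((2 * (ρ + r) + 1) ^ 2 : ℕ) : ℝ) ≤ (((2 * δ + 1) ^ 2 : ℕ) : ℝ) := by
      exact_mod_cast Nat.pow_le_pow_left h1 2
    have h0 : (0 : ℝ) ≤ δ := by positivity
    push_cast at h2 ⊢
    nlinarith [h2]
  have hM : (((4 * L' ^ 2 : ℕ) : ℝ)) ≤ 4 * ((δ : ℝ) + 1) ^ 4 := by
    push_cast
    have : (L' : ℝ) ^ 2 ≤ (((δ : ℝ) + 1) ^ 2) ^ 2 := pow_le_pow_left₀ hL'pos.le hLδ'.le 2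
    nlinarith
  have hAM : A * ((4 * L' ^ 2 : ℕ) : ℝ) ≤ 64 * α * Real.exp (4 * m * r) * ((δ : ℝ) + 1) ^ 10 *
      Real.exp (-(m * δ)) := by
    rw [hA, hexp]
    have h1 : α * ((4 * L' ^ 2 : ℕ) : ℝ) * (((2 * (ρ + r) + 1) ^ 2 : ℕ) : ℝ) *
        (Real.exp (4 * m * r) * Real.exp (-(m * δ))) * ((4 * L' ^ 2 : ℕ) : ℝ) =
        α * Real.exp (4 * m * r) * Real.exp (-(m * δ)) *
          ((((4 * L' ^ 2 : ℕ) : ℝ)) * (((4 * L' ^ 2 : ℕ) : ℝ)) * (((2 * (ρ + r) + 1) ^ 2 : ℕ) : ℝ)) := by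
      ring
    rw [h1]
    have h2 : (((4 * L' ^ 2 : ℕ) : ℝ)) * (((4 * L' ^ 2 : ℕ) : ℝ)) * (((2 * (ρ + r) + 1) ^ 2 : ℕ) : ℝ) ≤
        (4 * ((δ : ℝ) + 1) ^ 4) * (4 * ((δ : ℝ) + 1) ^ 4) * (4 * ((δ : ℝ) + 1) ^ 2) := by
      gcongr
    calc α * Real.exp (4 * m * r) * Real.exp (-(m * δ)) *
          ((((4 * L' ^ 2 : ℕ) : ℝ)) * (((4 * L' ^ 2 : ℕ) : ℝ)) * (((2 * (ρ + r) + 1) ^ 2 : ℕ) : ℝ))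
        ≤ α * Real.exp (4 * m * r) * Real.exp (-(m * δ)) *
          ((4 * ((δ : ℝ) + 1) ^ 4) * (4 * ((δ : ℝ) + 1) ^ 4) * (4 * ((δ : ℝ) + 1) ^ 2)) :=
          mul_le_mul_of_nonneg_left h2 (by positivity)
      _ = 64 * α * Real.exp (4 * m * r) * ((δ : ℝ) + 1) ^ 10 * Real.exp (-(m * δ)) := by ring
  -- `(δ+1)^{12} ≤ 2^{12} δ^{12}`, so `8 (δ+1)² · A M ≤ Cψ δ^{12} e^{−mδ} < 1`
  have hsmall := hδ₀ δ hδ₀δ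
  have hδ12 : ((δ : ℝ) + 1) ^ 12 ≤ 2 ^ 12 * (δ : ℝ) ^ 12 := by
    rw [← mul_pow]; exact pow_le_pow_left₀ (by positivity) (by linarith) 12
  have hAM8 : 8 * ((δ : ℝ) + 1) ^ 2 * (A * ((4 * L' ^ 2 : ℕ) : ℝ)) ≤ 1 := by
    have h1 : 8 * ((δ : ℝ) + 1) ^ 2 * (64 * α * Real.exp (4 * m * r) * ((δ : ℝ) + 1) ^ 10 *
        Real.exp (-(m * δ))) = 512 * α * Real.exp (4 * m * r) * ((δ : ℝ) + 1) ^ 12 * Real.exp (-(m * δ)) := by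
      ring
    have h2 : 512 * α * Real.exp (4 * m * r) * ((δ : ℝ) + 1) ^ 12 * Real.exp (-(m * δ)) ≤
        Cψ * ((δ : ℝ) ^ 12 * Real.exp (-(m * (δ : ℝ)))) := by
      rw [hCψ]
      have h3 : 512 * α * Real.exp (4 * m * r) * ((δ : ℝ) + 1) ^ 12 ≤ 512 * α * Real.exp (4 * m * r) *
          (2 ^ 12 * (δ : ℝ) ^ 12) := mul_le_mul_of_nonneg_left hδ12 (by positivity)
      have h4 := mul_le_mul_of_nonneg_right h3 (Real.exp_pos (-(m * (δ : ℝ)))).le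
      have h5 : 512 * α * Real.exp (4 * m * r) * (2 ^ 12 * (δ : ℝ) ^ 12) * Real.exp (-(m * (δ : ℝ))) ≤
          2 ^ 21 * α * Real.exp (4 * m * r) * ((δ : ℝ) ^ 12 * Real.exp (-(m * (δ : ℝ)))) := by
        have : 0 ≤ α * Real.exp (4 * m * r) * ((δ : ℝ) ^ 12 * Real.exp (-(m * (δ : ℝ)))) := by positivity
        nlinarith
      exact h4.trans h5
    calc 8 * ((δ : ℝ) + 1) ^ 2 * (A * ((4 * L' ^ 2 : ℕ) : ℝ))
        ≤ 8 * ((δ : ℝ) + 1) ^ 2 * (64 * α * Real.exp (4 * m * r) * ((δ : ℝ) + 1) ^ 10 * Real.exp (-(m * δ))) :=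
          mul_le_mul_of_nonneg_left hAM (by positivity)
      _ ≤ 1 := by rw [h1]; exact h2.trans hsmall.le
  have hAM1 : A * ((4 * L' ^ 2 : ℕ) : ℝ) ≤ 1 := by
    have h1 : (1 : ℝ) ≤ 8 * ((δ : ℝ) + 1) ^ 2 := by nlinarith
    have h2 : 0 ≤ A * ((4 * L' ^ 2 : ℕ) : ℝ) := by positivity
    calc A * ((4 * L' ^ 2 : ℕ) : ℝ) = 1 * (A * ((4 * L' ^ 2 : ℕ) : ℝ)) := (one_mul _).symm
      _ ≤ 8 * ((δ : ℝ) + 1) ^ 2 * (A * ((4 * L' ^ 2 : ℕ) : ℝ)) := mul_le_mul_of_nonneg_right h1 h2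
      _ ≤ 1 := hAM8
  have hκle : κ ≤ 2 * (A * ((4 * L' ^ 2 : ℕ) : ℝ)) := by
    rw [hκA]
    have h1 : (1 + A) ^ (4 * L' ^ 2) ≤ Real.exp (A * ((4 * L' ^ 2 : ℕ) : ℝ)) := by
      rw [show A * ((4 * L' ^ 2 : ℕ) : ℝ) = ((4 * L' ^ 2 : ℕ) : ℝ) * A by ring, Real.exp_nat_mul]
      exact pow_le_pow_left₀ (by positivity) (by linarith [Real.add_one_le_exp A]) _
    have h2 : |Real.exp (A * ((4 * L' ^ 2 : ℕ) : ℝ)) - 1| ≤ 2 * |A * ((4 * L' ^ 2 : ℕ) : ℝ)| :=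
      Real.abs_exp_sub_one_le (by rw [abs_of_nonneg (by positivity)]; exact hAM1)
    rw [abs_of_nonneg (show (0 : ℝ) ≤ A * ((4 * L' ^ 2 : ℕ) : ℝ) by positivity)] at h2
    have h3 := (abs_le.1 h2).2
    linarith
  have hκL : κ ≤ 1 / (4 * (L' : ℝ)) := by
    have h1 : κ * (8 * ((δ : ℝ) + 1) ^ 2) ≤ 2 := by
      have h2 : κ * (8 * ((δ : ℝ) + 1) ^ 2) ≤ 2 * (A * ((4 * L' ^ 2 : ℕ) : ℝ)) * (8 * ((δ : ℝ) + 1) ^ 2) :=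
        mul_le_mul_of_nonneg_right hκle (by positivity)
      have h3 : 2 * (A * ((4 * L' ^ 2 : ℕ) : ℝ)) * (8 * ((δ : ℝ) + 1) ^ 2) =
          2 * (8 * ((δ : ℝ) + 1) ^ 2 * (A * ((4 * L' ^ 2 : ℕ) : ℝ))) := by ring
      linarith [hAM8]
    rw [le_div_iff₀ (by positivity)]
    have hκ0' : 0 ≤ κ := by rw [hκA, sub_nonneg]; exact one_le_pow₀ (by linarith)
    have h4 : κ * (4 * (L' : ℝ)) ≤ κ * (4 * ((δ : ℝ) + 1) ^ 2) :=
      mul_le_mul_of_nonneg_left (by linarith) hκ0'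
    linarith
  have hκ0 : 0 ≤ κ := by
    rw [hκA, sub_nonneg]; exact one_le_pow₀ (by linarith)
  have hL'1 : (1 : ℝ) ≤ L' := by exact_mod_cast (show 1 ≤ L' by nlinarith)
  have hκhalf : κ < 1 / 2 := by
    have : 1 / (4 * (L' : ℝ)) ≤ 1 / 4 := by
      apply div_le_div_of_nonneg_left (by norm_num) (by norm_num)
      linarith
    linarith
  -- the scale step
  have hstep := fatRectangles_logSobolev_step U β hR1 hR hm hSMT (L' := L') (δ := δ - r) (N := N) (ρ := ρ)
    hNpos (by omega) (by omega) (by omega) (by omega) hNδ' hρL (κ := κ) (by rw [hκ]) hκhalf hk0 hm'pos hGB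
    hcs hLSI hL'' Q hQ τ
  refine hstep.mono (mul_le_mul_of_nonneg_right ?_ hcs)
  -- `F² ≤ 1 + 3K₀/√L'`
  set x : ℝ := 1 / Real.sqrt L' with hx
  have hsqrtL : 0 < Real.sqrt L' := Real.sqrt_pos.2 hL'pos
  have hx0 : 0 ≤ x := by positivity
  have hδle : (δ : ℝ) ≤ Real.sqrt L' := by
    rw [Real.le_sqrt (by positivity) hL'pos.le]
    have : ((δ * δ : ℕ) : ℝ) ≤ L' := by exact_mod_cast hδL
    push_cast at this; nlinarith
  have hδsq : Real.sqrt L' < (δ : ℝ) + 1 := by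
    rw [Real.sqrt_lt' (by positivity)]; exact hLδ'
  have hδ96' : (96 : ℝ) ≤ δ := by exact_mod_cast hδ96
  have hs96 : (96 : ℝ) ≤ Real.sqrt L' := hδ96'.trans hδle
  have hx1 : x ≤ 1 := by
    rw [hx, div_le_one hsqrtL]; linarith
  have hxsq : x * x = 1 / (L' : ℝ) := by
    rw [hx, div_mul_div_comm, one_mul, Real.mul_self_sqrt hL'pos.le]
  -- (i) the density factor
  have hE1 : 1 ≤ ((1 - κ / (1 - κ))⁻¹) ^ 2 := by
    refine one_le_pow₀ ?_
    have hε0 : 0 ≤ κ / (1 - κ) := div_nonneg hκ0 (by linarith)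
    have hε1 : κ / (1 - κ) < 1 := by rw [div_lt_one (by linarith)]; linarith
    rw [le_inv_comm₀ one_pos (by linarith), inv_one]; linarith
  have hE2 : ((1 - κ / (1 - κ))⁻¹) ^ 2 ≤ 1 + x := by
    refine inv_one_sub_div_sq_le hκ0 ?_ hx1
    -- `κ ≤ 1/(4L') = x²/4 ≤ x/16` since `x ≤ 1/96`
    have h1 : 1 / (4 * (L' : ℝ)) ≤ x / 16 := by
      have e : 1 / (4 * (L' : ℝ)) = x * x / 4 := by rw [hxsq]; ring
      have hx4 : x ≤ 1 / 96 := by rw [hx]; exact one_div_le_one_div_of_le (by norm_num) hs96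
      rw [e]; nlinarith [hx0]
    exact hκL.trans h1
  -- (ii) the Lemma 4.7 error `η ≤ x`
  have hδr' : (((δ - r : ℕ) : ℕ) : ℝ) = (δ : ℝ) - r := by
    have : r ≤ δ := by omega
    rw [Nat.cast_sub this]
  have hη : k * K₂ * Real.exp (-(m' / 2 * ((δ - r : ℕ) : ℝ))) ≤ x := by
    have hsm := hδ₁ δ hδ₁δ
    rw [pow_one] at hsm
    have hδpos : (0 : ℝ) < δ := by linarith
    -- `k K₂ e^{−m'(δ−r)/2} = (Cη/2) e^{−m'δ/2}` and `Cη δ e^{−m'δ/2} < 1`, `x ≥ 1/(δ+1) ≥ 1/(2δ)`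
    have e1 : k * K₂ * Real.exp (-(m' / 2 * ((δ - r : ℕ) : ℝ))) = Cη / 2 * Real.exp (-(m' / 2 * (δ : ℝ))) := by
      rw [hδr', hCη, show -(m' / 2 * ((δ : ℝ) - r)) = m' / 2 * r + -(m' / 2 * (δ : ℝ)) by ring, Real.exp_add]
      ring
    rw [e1]
    have h2 : Cη / 2 * Real.exp (-(m' / 2 * (δ : ℝ))) * (2 * δ) < 1 := by
      have : Cη / 2 * Real.exp (-(m' / 2 * (δ : ℝ))) * (2 * δ) = Cη * ((δ : ℝ) * Real.exp (-(m' / 2 * (δ : ℝ)))) := by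
        ring
      rw [this]; exact hsm
    have h3 : Cη / 2 * Real.exp (-(m' / 2 * (δ : ℝ))) ≤ 1 / (2 * (δ : ℝ)) := by
      rw [le_div_iff₀ (by positivity)]; exact h2.le
    have h4 : 1 / (2 * (δ : ℝ)) ≤ x := by
      rw [hx]; exact one_div_le_one_div_of_le hsqrtL (by linarith [hδsq])
    exact h3.trans h4
  -- (iii) `1/N ≤ 96 x`
  have hN0r : (0 : ℝ) < N := by exact_mod_cast hNpos
  have hN1r : (Real.sqrt L') / 48 ≤ (N : ℝ) + 1 := by
    have h1 : ((N + 1 : ℕ) : ℝ) = ((L' / (12 * δ) : ℕ) : ℝ) := by rw [hN1]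
    have h2 : (L' : ℝ) - 12 * δ < ((L' / (12 * δ) : ℕ) : ℝ) * (12 * δ) := by
      have h3 : L' < (L' / (12 * δ) + 1) * (12 * δ) := by
        have := Nat.lt_div_mul_add (a := L') (b := 12 * δ) (by omega)
        linarith
      have h4 : ((L' : ℕ) : ℝ) < (((L' / (12 * δ) + 1) * (12 * δ) : ℕ) : ℝ) := by exact_mod_cast h3
      push_cast at h4; linarith
    have hδpos : (0 : ℝ) < δ := by linarith
    have h5 : ((L' / (12 * δ) : ℕ) : ℝ) > (L' : ℝ) / (12 * δ) - 1 := by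
      rw [gt_iff_lt, sub_lt_iff_lt_add, div_lt_iff₀ (by positivity)]; linarith
    have h6 : (δ : ℝ) / 12 ≤ (L' : ℝ) / (12 * δ) := by
      rw [div_le_div_iff₀ (by norm_num) (by positivity)]
      have : ((δ * δ : ℕ) : ℝ) ≤ L' := by exact_mod_cast hδL
      push_cast at this; nlinarith
    have h7 : ((N : ℕ) : ℝ) + 1 = ((N + 1 : ℕ) : ℝ) := by push_cast; ring
    rw [h7, h1]
    linarith
  have hν : 1 / (N : ℝ) ≤ 96 * x := inv_le_mul_inv_sqrt hs96 hN1r hN0r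
  -- (iv) `K₀ x ≤ 1`
  have hK₀δ : K₀ ≤ (δ : ℝ) := le_trans (Nat.le_ceil K₀) (by exact_mod_cast hδK₀)
  have hxK : K₀ * x ≤ 1 := by
    rw [hx, mul_one_div, div_le_one hsqrtL]; linarith
  -- assemble
  have hmain := rate_sq_le hx0 hE1 hE2 (by positivity) hη (by positivity) hν hk₁0 hK₀ hxK
  have e3 : 1 + 3 * K₀ / Real.sqrt L' = 1 + 3 * K₀ * x := by rw [hx]; ring
  rw [e3]
  refine le_trans (le_of_eq ?_) hmain
  rw [hk₁, hK₁, hK₂]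
  ring

end Glauber

end Literature.Probability.LatticeModels

end
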